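import Summits.AtomisticToContinuum.Crystallization.Theses.ChartedPlanarOrder
import Summits.AtomisticToContinuum.Crystallization.Theses.NashClassCertificates
import Summits.AtomisticToContinuum.Crystallization.Theorems.HullMinimalityLayeredWindowsFrequently

/-!
# `stub_nnfDoor` (line `nnf-door` of crux `ChartedPlanarOrder.CleanBallPlanarOrder`, stmt-32136) — discharged

decomp-a2c · lens-3 · g7.  The stub is, verbatim, the landed theorem
`LayeredWindowsLocal.layeredWindows_seq_of_goodWindows_freq` (route `HullMinimality`, line `registered` of
`LayeredWindows`): the Nash near field (`NashClassCertificates.NashNearField`, stmt-16827) turns clean balls into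
layered Barlow windows at one scale `a ∈ [47/50, 1]`, two-way matched frequently in `N`.  0 sorry. [folklore]
-/

namespace Summit.AtomisticToContinuum.Crystallization.Theorems.ChartedPlanarOrderNnfDoor

/-- **`stub_nnfDoor`** (registered on stmt-AtomisticToContinuum-32136), statement verbatim. -/
theorem stub_nnfDoor : Summit.AtomisticToContinuum.Crystallization.Theses.NashClassCertificates.NashNearField → ∀ x : (N : ℕ) → (Fin N → EuclideanSpace ℝ (Fin 3)), (∀ N, Literature.MathematicalPhysics.StatisticalMechanics.IsGroundState Literature.MathematicalPhysics.StatisticalMechanics.lennardJones (x N)) → (∀ ρ : ℝ, ∃ᶠ N in Filter.atTop, ∃ i : Fin N, ∀ j : Fin N, dist (x N j) (x N i) ≤ ρ → Literature.Geometry.DiscreteGeometry.IsTwoShellGood (1 / 20) (47 / 50) 1 (x N) j) → ∃ a : ℝ, 47 / 50 ≤ a ∧ a ≤ 1 ∧ (∀ R ε : ℝ, 0 < ε → ∃ᶠ N in Filter.atTop, ∃ (A : EuclideanSpace ℝ (Fin 3) →ₗᵢ[ℝ] EuclideanSpace ℝ (Fin 3)) (t : EuclideanSpace ℝ (Fin 3))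 (s : ℤ → ℤ) (z : ℤ → ℝ), Literature.MathematicalPhysics.StatisticalMechanics.IsHaggSeq s ∧ (∀ m : ℤ, 39 / 50 * a ≤ z (m + 1) - z m ∧ z (m + 1) - z m ≤ 17 / 20 * a) ∧ let S : Set (EuclideanSpace ℝ (Fin 3)) := {p | ∃ m i j : ℤ, p = A ((((i : ℝ) • Literature.MathematicalPhysics.StatisticalMechanics.triangularVec₁ a) + ((j : ℝ) • Literature.MathematicalPhysics.StatisticalMechanics.triangularVec₂ a) + ((Literature.MathematicalPhysics.StatisticalMechanics.haggLabel s m : ℝ) • Literature.MathematicalPhysics.StatisticalMechanics.barlowOffset a) + (z m • Literature.MathematicalPhysics.StatisticalMechanics.layerNormal 1)))}; (∀ p ∈ S, ‖p‖ ≤ R → ∃ i : Fin N, dist (x N i + t) p ≤ ε) ∧ (∀ i : Fin N, ‖x N i + t‖ ≤ R → ∃ p ∈ S, dist (x N i + t) p ≤ ε)) :=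
  fun hNF x hx hgood =>
    Summit.AtomisticToContinuum.Crystallization.Theorems.LayeredWindowsLocal.layeredWindows_seq_of_goodWindows_freq
      hNF x hx hgood

end Summit.AtomisticToContinuum.Crystallization.Theorems.ChartedPlanarOrderNnfDoor
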